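import Summits.AtomisticToContinuum.HydrodynamicLimit.Theorems.OneFlightGossipEngineClampedCurrentsDockPathwise
import Summits.AtomisticToContinuum.HydrodynamicLimit.Theorems.OneFlightGossipEngineClampedCurrentsDockClampRemainder
import Summits.AtomisticToContinuum.HydrodynamicLimit.Theorems.OneFlightGossipEngineEnergyCurrentTailsLevelCensusEventMeasurable
import Literature.Analysis.FluidPDE.EmpiricalCollisionMeasureMeasurableLabels
import Literature.MathematicalPhysics.KineticTheory.HardSphereEuler
import HarnessLib

/-!
# Window continuity of the relative-entropy ledger, in band — the collisional transfer
(helper of stub `stub_windowContinuityInBand`, line `IdeatorOneSketch`, crux `HydroLimitInBand`,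
stmt-AtomisticToContinuum-9133)

Support file (`--supports stmt-AtomisticToContinuum-9133`). The collisional side of the crude short-time
continuity of `H_N(s) = KL(f_s ‖ ψ_s)`: along a good orbit of the hard-sphere flow of `N + 1` spheres of
diameter `ε_N = hsDiameter σ N` on `𝕋³` (`0 < σ < 1/2`) the collision sum of the sibling dock's pair kernel
`½{Σ_k [(u_k/θ)(x_fst) − (u_k/θ)(x_snd)] Δv_k − [θ⁻¹(x_fst) − θ⁻¹(x_snd)] Δe}` over a window `(s, s']`
(`ClampedCurrentsDockPathwise.pairKernel`, the collisional part of `gSum_sub_eq`) is bounded by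
`4 L ε_N Σ_i A_i`, `A_i` the TRANSFER activity of particle `i` (`abs_collisionSum_pairKernel_le`: contact puts
the partners at minimal-image distance `ε_N`, the coefficient fields are `L`-Lipschitz in space, and the
sibling's clamp-remainder bound `ClampedCurrentsDockClampRemainder.abs_collisionSum_unclamped_le_transfer` with
the trivial clamp); the transfer activity splits into the momentum and the energy activity
(`sum_collisionSum_transfer_eq`), each monotone in the window (`collisionSum_mono_window`); the momentum
activity is a.e.-measurable in the initial datum (`aemeasurable_momActivity`, the label-aware collision-sum
engine `EmpiricalCollisionMeasureMeasurableLabels` through the elastic law read off the mark,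
`EnergyCurrentTailsLevelCensus.ofConfig_postVel_eq_of_mem_contactSet`); and an `L¹` tail bound of the shape
of `CollisionActivityTails` / its energy twin at ONE fixed level `V` gives the expectation bound
`E[Σ_i A_i] ≤ κ⁻¹ (N+1)(V+1)` (`lintegral_sum_le_of_tail`, `lintegral_sum_collisionSum_le_of_tail`).

References: H.-T. Yau, Lett. Math. Phys. 22 (1991) §2; R. Soto, *Kinetic Theory and Transport Phenomena*
(2016) §4.8.1 (collisional transfer).
-/

noncomputable section

open MeasureTheory Filter Set Topology
open scoped ENNReal InnerProductSpace

namespace Summit.AtomisticToContinuum.HydrodynamicLimit.Theorems.HydroLimitInBandContinuity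

open Literature.MathematicalPhysics.KineticTheory Literature.Analysis.FluidPDE
open Literature.Analysis.FunctionSpaces
open Summit.AtomisticToContinuum.HydrodynamicLimit.Theorems.ClampedCurrentsDockPathwise (pairKernel)
open Summit.AtomisticToContinuum.HydrodynamicLimit.Theorems.ClampedCurrentsDockClampRemainder
  (abs_collisionSum_unclamped_le_transfer)
open Summit.AtomisticToContinuum.HydrodynamicLimit.Theorems.EnergyCurrentTailsLevelCensus
  (ofConfig_postVel_eq_of_mem_contactSet)

variable {σ : ℝ} {N : ℕ}

/-! ### §1 The pair kernel is dominated by the transfer impulse at contact -/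

/-- **Pointwise bound on the pair kernel.** If the coefficient fields `u_j/θ` (`j = 0, 1, 2`) and `θ⁻¹`
are `L`-Lipschitz in space for the minimal-image distance at all times of `[0, t₁]`, then for a collision
record at a time of `[0, t₁]` whose partners are at minimal-image distance `ε`,
`|pairKernel| ≤ 2 L ε (‖Δv_fst‖ + |‖v_fst⁺‖² − ‖v_fst⁻‖²|/2)` (coordinates are bounded by the norm). [folklore] -/
theorem abs_pairKernel_le {θ : ℝ → T3 → ℝ} {u : ℝ → T3 → V3} {L t₁ : ℝ}
    (hβ : ∀ r ∈ Icc 0 t₁, ∀ (x x' : T3) (j : Fin 3),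
      |u r x j / θ r x - u r x' j / θ r x'| ≤ L * Torus.euclidDist x x')
    (hγ : ∀ r ∈ Icc 0 t₁, ∀ x x' : T3, |(θ r x)⁻¹ - (θ r x')⁻¹| ≤ L * Torus.euclidDist x x')
    (c : HardSphereCollisionRecord (Fin 3) T3 (N + 1)) (hc : c.time ∈ Icc 0 t₁) {ε : ℝ}
    (hLε : 0 ≤ L * ε) (hdist : Torus.euclidDist c.fstPos c.sndPos = ε) :
    |pairKernel θ u c| ≤ 2 * L * ε *
      (‖c.postVel.1 - c.preVel.1‖ + |‖c.postVel.1‖ ^ 2 - ‖c.preVel.1‖ ^ 2| / 2) := by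
  have hdv : ∀ k : Fin 3, |c.postVel.1 k - c.preVel.1 k| ≤ ‖c.postVel.1 - c.preVel.1‖ := fun k => by
    have h := PiLp.norm_apply_le (c.postVel.1 - c.preVel.1) k
    simpa only [PiLp.sub_apply, Real.norm_eq_abs] using h
  have h1 : |∑ k : Fin 3, (u c.time c.fstPos k / θ c.time c.fstPos - u c.time c.sndPos k / θ c.time c.sndPos) *
      (c.postVel.1 k - c.preVel.1 k)| ≤ 3 * (L * ε) * ‖c.postVel.1 - c.preVel.1‖ := by
    calc |∑ k : Fin 3, (u c.time c.fstPos k / θ c.time c.fstPos - u c.time c.sndPos k / θ c.time c.sndPos) *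
          (c.postVel.1 k - c.preVel.1 k)|
        ≤ ∑ k : Fin 3, |(u c.time c.fstPos k / θ c.time c.fstPos - u c.time c.sndPos k / θ c.time c.sndPos) *
          (c.postVel.1 k - c.preVel.1 k)| := Finset.abs_sum_le_sum_abs _ _
      _ ≤ ∑ _k : Fin 3, L * ε * ‖c.postVel.1 - c.preVel.1‖ := Finset.sum_le_sum fun k _ => by
          rw [abs_mul]
          exact mul_le_mul ((hβ _ hc _ _ k).trans (by rw [hdist])) (hdv k) (abs_nonneg _) hLε
      _ = 3 * (L * ε) * ‖c.postVel.1 - c.preVel.1‖ := by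
          rw [Finset.sum_const, Finset.card_univ, Fintype.card_fin, nsmul_eq_mul]
          push_cast
          ring
  have h2 : |((θ c.time c.fstPos)⁻¹ - (θ c.time c.sndPos)⁻¹) * ((‖c.postVel.1‖ ^ 2 - ‖c.preVel.1‖ ^ 2) / 2)| ≤
      L * ε * (|‖c.postVel.1‖ ^ 2 - ‖c.preVel.1‖ ^ 2| / 2) := by
    rw [abs_mul, abs_div, abs_two]
    exact mul_le_mul_of_nonneg_right ((hγ _ hc _ _).trans (by rw [hdist])) (by positivity)
  have hn1 := norm_nonneg (c.postVel.1 - c.preVel.1)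
  have hn2 : 0 ≤ |‖c.postVel.1‖ ^ 2 - ‖c.preVel.1‖ ^ 2| / 2 := by positivity
  unfold pairKernel
  rw [abs_div, abs_two]
  have h3 := abs_sub _ _ |>.trans (add_le_add h1 h2)
  rw [div_le_iff₀ two_pos]
  nlinarith [mul_nonneg hLε hn1, mul_nonneg hLε hn2]

/-- **The collision sum of the pair kernel is dominated by the transfer activities.** For `0 < σ < 1/2`,
a good datum `z` and a window `(s, s'] ⊆ [0, t₁]` on which the coefficient fields are `L`-Lipschitz in
space (`0 ≤ L`): `|Σ_{(s, s']} pairKernel| ≤ 4 L ε_N Σ_i A_i`, `A_i = Σ_{c : c.fst = i} (‖Δv_fst‖ + |Δ‖v_fst‖²|/2)`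
(contact: `d(x_fst, x_snd) = ε_N`; the sibling's `abs_collisionSum_unclamped_le_transfer` with the trivial
clamp `ω = 0`). [cite: Yau1991, §2] -/
theorem abs_collisionSum_pairKernel_le (hσ : 0 < σ) (hσ2 : σ < 1 / 2)
    (Φ : HardSphereFlow (Torus.geometry (Fin 3)) (hsDiameter σ N) (N + 1))
    {θ : ℝ → T3 → ℝ} {u : ℝ → T3 → V3} {L t₁ : ℝ} (hL0 : 0 ≤ L)
    (hβ : ∀ r ∈ Icc 0 t₁, ∀ (x x' : T3) (j : Fin 3),
      |u r x j / θ r x - u r x' j / θ r x'| ≤ L * Torus.euclidDist x x')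
    (hγ : ∀ r ∈ Icc 0 t₁, ∀ x x' : T3, |(θ r x)⁻¹ - (θ r x')⁻¹| ≤ L * Torus.euclidDist x x')
    {z : Config (N + 1) (Fin 3) T3} (hz : z ∈ Φ.good) {s s' : ℝ} (hs : 0 ≤ s) (hs't : s' ≤ t₁) :
    |Φ.collisionSum (Ioc s s') (pairKernel θ u) z| ≤
      4 * L * hsDiameter σ N * ∑ i, Φ.collisionSum (Ioc s s')
        (fun c => if c.fst = i then ‖c.postVel.1 - c.preVel.1‖ + |‖c.postVel.1‖ ^ 2 - ‖c.preVel.1‖ ^ 2| / 2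
          else 0) z := by
  have hε : hsDiameter σ N < 2⁻¹ := (hsDiameter_le hσ.le N).trans_lt (by rw [inv_eq_one_div]; exact hσ2)
  have hε0 : 0 < hsDiameter σ N := hsDiameter_pos hσ N
  have hG := Torus.isHardSphereRegular_geometry (d := Fin 3) hε
  have hfin := Φ.finite_collisionTimes_inter hz (S := Ioc s s') Ioc_subset_Icc_self
  have h := abs_collisionSum_unclamped_le_transfer hG hfin (ω := fun _ => (0 : ℝ)) (fun _ => le_rfl)
    (fun _ => zero_le_one) (g := pairKernel θ u) (B := 2 * L * hsDiameter σ N) fun t ht p hp => by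
      have hc := (mem_contactPairs.1 hp).2
      have hd : Torus.euclidDist (Φ.flow t z p.1).1 (Φ.flow t z p.2).1 = hsDiameter σ N :=
        (mem_contactSet.1 hc).2
      exact abs_pairKernel_le hβ hγ _ ⟨hs.trans ht.2.1.le, ht.2.2.trans hs't⟩ (mul_nonneg hL0 hε0.le) hd
  simp only [mul_zero, sub_zero, one_mul] at h
  rw [HardSphereFlow.collisionSum_eq]
  refine h.trans (le_of_eq ?_)
  simp only [HardSphereFlow.collisionSum_eq]
  ring

/-! ### §2 Splitting and window monotonicity of the activities -/

/-- The transfer activity is the momentum activity plus the energy activity (good data: finitely many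
collisions in the window). [folklore] -/
theorem sum_collisionSum_transfer_eq (Φ : HardSphereFlow (Torus.geometry (Fin 3)) (hsDiameter σ N) (N + 1))
    {z : Config (N + 1) (Fin 3) T3} (hz : z ∈ Φ.good) (s s' : ℝ) :
    ∑ i, Φ.collisionSum (Ioc s s')
        (fun c => if c.fst = i then ‖c.postVel.1 - c.preVel.1‖ + |‖c.postVel.1‖ ^ 2 - ‖c.preVel.1‖ ^ 2| / 2
          else 0) z =
      ∑ i, Φ.collisionSum (Ioc s s') (fun c => if c.fst = i then ‖c.postVel.1 - c.preVel.1‖ else 0) z +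
        ∑ i, Φ.collisionSum (Ioc s s')
          (fun c => if c.fst = i then |‖c.postVel.1‖ ^ 2 - ‖c.preVel.1‖ ^ 2| / 2 else 0) z := by
  rw [← Finset.sum_add_distrib]
  refine Finset.sum_congr rfl fun i _ => ?_
  have hfin := Φ.finite_collisionTimes_inter hz (S := Ioc s s') Ioc_subset_Icc_self
  simp only [HardSphereFlow.collisionSum_eq, collisionSum_eq_collisionPairSum]
  rw [← collisionPairSum_add hfin]
  congr 1
  funext t k l
  split_ifs <;> simp

/-- A collision sum of a nonnegative functional over `(s, s']` is monotone in `s'` along a good orbit.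
[folklore] -/
theorem collisionSum_mono_window (Φ : HardSphereFlow (Torus.geometry (Fin 3)) (hsDiameter σ N) (N + 1))
    {z : Config (N + 1) (Fin 3) T3} (hz : z ∈ Φ.good) {F : HardSphereCollisionRecord (Fin 3) T3 (N + 1) → ℝ}
    (hF : ∀ c, 0 ≤ F c) {s s' s'' : ℝ} (hss' : s ≤ s') (hs's'' : s' ≤ s'') :
    Φ.collisionSum (Ioc s s') F z ≤ Φ.collisionSum (Ioc s s'') F z := by
  have h1 := Φ.finite_collisionTimes_inter hz (S := Ioc s s') Ioc_subset_Icc_self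
  have h2 := Φ.finite_collisionTimes_inter hz (S := Ioc s' s'') Ioc_subset_Icc_self
  simp only [HardSphereFlow.collisionSum_eq, collisionSum_eq_collisionPairSum]
  rw [← Ioc_union_Ioc_eq_Ioc hss' hs's'', collisionPairSum_union h1 h2 (Ioc_disjoint_Ioc_of_le le_rfl)]
  exact le_add_of_nonneg_right (collisionPairSum_nonneg fun _ _ _ => hF _)

/-- A collision sum of a nonnegative functional is nonnegative (every datum). [folklore] -/
theorem collisionSum_nonneg' (Φ : HardSphereFlow (Torus.geometry (Fin 3)) (hsDiameter σ N) (N + 1))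
    {F : HardSphereCollisionRecord (Fin 3) T3 (N + 1) → ℝ} (hF : ∀ c, 0 ≤ F c) (S : Set ℝ)
    (z : Config (N + 1) (Fin 3) T3) : 0 ≤ Φ.collisionSum S F z := by
  simp only [HardSphereFlow.collisionSum_eq, collisionSum_eq_collisionPairSum]
  exact collisionPairSum_nonneg fun _ _ _ => hF _

/-! ### §3 Measurability of the momentum activity -/

/-- **The momentum activity of a particle is a.e.-measurable in the initial datum** under any law carried
by the good set (`0 < σ < 1/2`): on the collisions of an orbit `‖v_fst⁺ − v_fst⁻‖ = ‖⟪v_fst⁻ − v_snd⁻, ω⟫ ω‖` is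
a continuous function of the mark (the elastic law, `ofConfig_postVel_eq_of_mem_contactSet`), so the
label-aware engine `HardSphereFlow.aemeasurable_of_eqOn_collisionSum_labels_torus` applies. [folklore] -/
theorem aemeasurable_momActivity (hσ : 0 < σ) (hσ2 : σ < 1 / 2)
    (Φ : HardSphereFlow (Torus.geometry (Fin 3)) (hsDiameter σ N) (N + 1)) (i : Fin (N + 1)) (a b : ℝ)
    {μ : Measure (Config (N + 1) (Fin 3) T3)} (hμ : ∀ᵐ z ∂μ, z ∈ Φ.good) :
    AEMeasurable (fun z => Φ.collisionSum (Ioc a b)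
      (fun c => if c.fst = i then ‖c.postVel.1 - c.preVel.1‖ else 0) z) μ := by
  have hε : hsDiameter σ N < 2⁻¹ := (hsDiameter_le hσ.le N).trans_lt (by rw [inv_eq_one_div]; exact hσ2)
  have hε0 : 0 < hsDiameter σ N := hsDiameter_pos hσ N
  have hFc : ∀ k l : Fin (N + 1), Continuous fun m : ℝ × T3 × V3 × V3 × V3 =>
      if k = i then ‖⟪m.2.2.2.1 - m.2.2.2.2, m.2.2.1⟫_ℝ • m.2.2.1‖ else 0 := by
    intro k l
    by_cases hk : k = i
    · simp only [hk, if_true]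
      fun_prop
    · simp only [hk, if_false]
      exact continuous_const
  refine Φ.aemeasurable_of_eqOn_collisionSum_labels_torus hε hFc a b (fun z _ => ?_) hμ
  rw [HardSphereFlow.collisionSum_eq, HardSphereFlow.collisionSum_eq]
  refine collisionSum_congr fun t _ p hp => ?_
  obtain ⟨-, hc⟩ := mem_contactPairs.1 hp
  by_cases hpi : p.1 = i
  · have hpost := congrArg Prod.fst (ofConfig_postVel_eq_of_mem_contactSet hε0 t hc)
    simp only [HardSphereCollisionRecord.ofConfig_fst, HardSphereCollisionRecord.mark_def]
    rw [if_pos hpi, if_pos hpi, hpost, sub_sub_cancel_left, norm_neg]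
  · simp only [HardSphereCollisionRecord.ofConfig_fst]
    rw [if_neg hpi, if_neg hpi]

/-! ### §4 From an `L¹` tail bound at one level to an expectation bound -/

/-- **A tail bound at one level bounds the mean.** If `V ≥ 0` and
`E[(n+1)⁻¹ Σ_i 𝟙{V < a_i} a_i] ≤ 1` under a probability law, then `E[Σ_i a_i] ≤ (n+1)(V+1)` (pointwise
`a ≤ V + 𝟙{V < a} a`). [folklore] -/
theorem lintegral_sum_le_of_tail {Ω : Type*} [MeasurableSpace Ω] (P : Measure Ω) [IsProbabilityMeasure P]
    {n : ℕ} {V : ℝ} (hV : 0 ≤ V) {a : Fin (n + 1) → Ω → ℝ}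
    (h : ∫⁻ z, ENNReal.ofReal (((n : ℝ) + 1)⁻¹ *
      ∑ i, Set.indicator {y : ℝ | V < y} (fun y => y) (a i z)) ∂P ≤ ENNReal.ofReal 1) :
    ∫⁻ z, ENNReal.ofReal (∑ i, a i z) ∂P ≤ ENNReal.ofReal (((n : ℝ) + 1) * (V + 1)) := by
  have hN : (0 : ℝ) < (n : ℝ) + 1 := by positivity
  -- pointwise: `Σ a_i ≤ (n+1) V + (n+1) · ((n+1)⁻¹ Σ tails)`
  have hpt : ∀ z, ENNReal.ofReal (∑ i, a i z) ≤ ENNReal.ofReal (((n : ℝ) + 1) * V) +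
      ENNReal.ofReal ((n : ℝ) + 1) * ENNReal.ofReal (((n : ℝ) + 1)⁻¹ *
        ∑ i, Set.indicator {y : ℝ | V < y} (fun y => y) (a i z)) := by
    intro z
    have htail : ∀ i, a i z ≤ V + Set.indicator {y : ℝ | V < y} (fun y => y) (a i z) := fun i => by
      by_cases hi : V < a i z
      · rw [indicator_of_mem (show a i z ∈ {y : ℝ | V < y} from hi)]
        linarith
      · rw [indicator_of_notMem (show a i z ∉ {y : ℝ | V < y} from hi)]
        linarith
    have hT0 : 0 ≤ ∑ i, Set.indicator {y : ℝ | V < y} (fun y => y) (a i z) :=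
      Finset.sum_nonneg fun i _ => Set.indicator_nonneg (fun y hy => hV.trans (le_of_lt hy)) _
    rw [← ENNReal.ofReal_mul hN.le, ← ENNReal.ofReal_add (by positivity) (by positivity)]
    refine ENNReal.ofReal_le_ofReal ?_
    calc ∑ i, a i z ≤ ∑ i, (V + Set.indicator {y : ℝ | V < y} (fun y => y) (a i z)) :=
          Finset.sum_le_sum fun i _ => htail i
      _ = ((n : ℝ) + 1) * V + ((n : ℝ) + 1) * (((n : ℝ) + 1)⁻¹ *
            ∑ i, Set.indicator {y : ℝ | V < y} (fun y => y) (a i z)) := by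
          rw [Finset.sum_add_distrib, Finset.sum_const, Finset.card_univ, Fintype.card_fin, nsmul_eq_mul,
            ← mul_assoc, mul_inv_cancel₀ hN.ne', one_mul]
          push_cast
          ring
  calc ∫⁻ z, ENNReal.ofReal (∑ i, a i z) ∂P
      ≤ ∫⁻ z, (ENNReal.ofReal (((n : ℝ) + 1) * V) + ENNReal.ofReal ((n : ℝ) + 1) *
          ENNReal.ofReal (((n : ℝ) + 1)⁻¹ * ∑ i, Set.indicator {y : ℝ | V < y} (fun y => y) (a i z))) ∂P :=
        lintegral_mono hpt
    _ = ENNReal.ofReal (((n : ℝ) + 1) * V) + ENNReal.ofReal ((n : ℝ) + 1) *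
          ∫⁻ z, ENNReal.ofReal (((n : ℝ) + 1)⁻¹ * ∑ i, Set.indicator {y : ℝ | V < y} (fun y => y) (a i z)) ∂P := by
        rw [lintegral_add_left measurable_const, lintegral_const, measure_univ, mul_one,
          lintegral_const_mul' _ _ ENNReal.ofReal_ne_top]
    _ ≤ ENNReal.ofReal (((n : ℝ) + 1) * V) + ENNReal.ofReal ((n : ℝ) + 1) * ENNReal.ofReal 1 := by
        gcongr
    _ = ENNReal.ofReal (((n : ℝ) + 1) * (V + 1)) := by
        rw [← ENNReal.ofReal_mul hN.le, ← ENNReal.ofReal_add (by positivity) (by positivity)]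
        congr 1
        ring

/-- **From a window-activity tail bound to the mean activity over a shorter window.** For a nonnegative
functional `g` of collision records, a good-set-carried probability law `μ`, levels `V ≥ 0`, `κ > 0` and a
window `(s, s'] ⊆ (s, s + w]`: if `E[(N+1)⁻¹ Σ_i 𝟙{V < κ A_i(s, s+w)} κ A_i(s, s+w)] ≤ 1` (the shape of
`CollisionActivityTails` and of its energy twin), then `E[Σ_i A_i(s, s')] ≤ κ⁻¹ (N+1)(V+1)`,
`A_i(a, b) = Σ_{c : c.fst = i, c.time ∈ (a, b]} g c`. [cite: Yau1991, §2] -/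
theorem lintegral_sum_collisionSum_le_of_tail
    (Φ : HardSphereFlow (Torus.geometry (Fin 3)) (hsDiameter σ N) (N + 1))
    {μ : Measure (Config (N + 1) (Fin 3) T3)} [IsProbabilityMeasure μ] (hμ : ∀ᵐ z ∂μ, z ∈ Φ.good)
    {g : HardSphereCollisionRecord (Fin 3) T3 (N + 1) → ℝ} (hg : ∀ c, 0 ≤ g c) {s s' w κ V : ℝ}
    (hss' : s ≤ s') (hs'w : s' ≤ s + w) (hκ : 0 < κ) (hV : 0 ≤ V)
    (htail : ∫⁻ z, ENNReal.ofReal (((N : ℝ) + 1)⁻¹ * ∑ i : Fin (N + 1),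
      Set.indicator {y : ℝ | V < y} (fun y => y)
        (κ * Φ.collisionSum (Ioc s (s + w)) (fun c => if c.fst = i then g c else 0) z)) ∂μ ≤
      ENNReal.ofReal 1) :
    ∫⁻ z, ENNReal.ofReal (∑ i : Fin (N + 1),
        Φ.collisionSum (Ioc s s') (fun c => if c.fst = i then g c else 0) z) ∂μ ≤
      ENNReal.ofReal (κ⁻¹ * (((N : ℝ) + 1) * (V + 1))) := by
  have hF0 : ∀ (i : Fin (N + 1)) (c : HardSphereCollisionRecord (Fin 3) T3 (N + 1)),
      0 ≤ (if c.fst = i then g c else 0) := fun i c => by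
    split_ifs
    · exact hg c
    · exact le_rfl
  have hbig := lintegral_sum_le_of_tail μ hV
    (a := fun i z => κ * Φ.collisionSum (Ioc s (s + w)) (fun c => if c.fst = i then g c else 0) z) htail
  -- the shorter window, on the good set
  have hmono : ∀ᵐ z ∂μ, ENNReal.ofReal (∑ i : Fin (N + 1),
      Φ.collisionSum (Ioc s s') (fun c => if c.fst = i then g c else 0) z) ≤
      ENNReal.ofReal κ⁻¹ * ENNReal.ofReal (∑ i : Fin (N + 1),
        κ * Φ.collisionSum (Ioc s (s + w)) (fun c => if c.fst = i then g c else 0) z) := by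
    filter_upwards [hμ] with z hz
    rw [← ENNReal.ofReal_mul (inv_nonneg.2 hκ.le), Finset.mul_sum]
    refine ENNReal.ofReal_le_ofReal (Finset.sum_le_sum fun i _ => ?_)
    rw [← mul_assoc, inv_mul_cancel₀ hκ.ne', one_mul]
    exact collisionSum_mono_window Φ hz (hF0 i) hss' hs'w
  calc ∫⁻ z, ENNReal.ofReal (∑ i : Fin (N + 1),
        Φ.collisionSum (Ioc s s') (fun c => if c.fst = i then g c else 0) z) ∂μ
      ≤ ∫⁻ z, ENNReal.ofReal κ⁻¹ * ENNReal.ofReal (∑ i : Fin (N + 1),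
          κ * Φ.collisionSum (Ioc s (s + w)) (fun c => if c.fst = i then g c else 0) z) ∂μ :=
        lintegral_mono_ae hmono
    _ ≤ ENNReal.ofReal κ⁻¹ * ENNReal.ofReal (((N : ℝ) + 1) * (V + 1)) := by
        rw [lintegral_const_mul' _ _ ENNReal.ofReal_ne_top]
        gcongr
    _ = ENNReal.ofReal (κ⁻¹ * (((N : ℝ) + 1) * (V + 1))) := by
        rw [← ENNReal.ofReal_mul (inv_nonneg.2 hκ.le)]

end Summit.AtomisticToContinuum.HydrodynamicLimit.Theorems.HydroLimitInBandContinuity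

end
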